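import Summits.BirchSwinnertonDyer.BirchSwinnertonDyer.Theorems.Rank2Observatory2DescClRowCertLe
import Summits.BirchSwinnertonDyer.BirchSwinnertonDyer.Theorems.Rank2Observatory2DescClFamCore
import Summits.BirchSwinnertonDyer.BirchSwinnertonDyer.Theorems.Rank2Observatory2DescClFamReg
import Summits.BirchSwinnertonDyer.BirchSwinnertonDyer.Theorems.Rank2ObservatoryRank3Witness
import HarnessLib

/-!
# BirchSwinnertonDyer — rank ≥ 2 observatory: KERNEL-2DESC-CL v2.3 — per-curve soundness over a TWO-VIEW field (complex case)

HONEST FRAMING: per-curve certified theorems and census instruments; no claim on BSD in rank ≥ 2.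

The per-curve `r`-checker `checkLe r fc cc` of v2.2 (`…2DescClRowCertLe`; `r = 2`: the v2.0 checker with the
class count read strictly) only READS the v2.0 field record `fc : ClFieldCert` — its registry rows, `q`, `W₁`,
`W₂`, the characters, `ε`, `γ` — and its soundness proof uses the record's Minkowski sweep at exactly one point:
the classes of the primes above `q` generate `Cl(K)`.  This file re-proves that soundness with the sweep result
ABSTRACTED into a hypothesis (`rank_le_of_checkLe_cl_reg`: registry core `fc.checkReg`, complex field clause
`fc.checkField`, and any proof `hcl` of the generation statement), and instantiates it with the TWO-VIEW field
record of v2.3 (`ClFieldCertE`, `…2DescClFieldCertE`: the sweep covered jointly by the `α`-view `fe.base` and an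
`η`-view), whose curves are v2.0 `ClCurveCert` records against `fe.base` UNCHANGED:
`ClFieldCertE.checkE = base.checkField ∧ checkCoreE`, `rank_eq_of_checkLe_clE`, and the `K`-free row shapes
`rank_eq_of_certsELe` (model `(0, A, 0, B, C)`), `rank_eq_of_certsELe_complSq` (original model) and
`rank_eq_of_certsELe_scaled` (original model whose completed-square model is certified after the rescaling
`x ↦ d²x` that moves the 2-division root into `ℤ[α]`; `mordellWeilRank_scaleModel` of `…Rank3Witness`).
Population: the non-monogenic even-class-number tier-0 2-division fields with two coprime-index generators
(cut 2c-A of the census; 9 617 fields / 19 065 rank-2 rows by the scoping table `etaidx_j178948`), complex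
signature here; the totally real analogue is the next file.  New file only; nothing landed is touched.
Sorry-free; axioms `propext`, `Classical.choice`, `Quot.sound`.
[cite: Cassels1991LecturesEllipticCurves, §15] [cite: CremonaAlgorithms1997, §3.6] [cite: Cohen1993, §6.2, §6.5]
[cite: SilvermanAEC2009, III.3.1(b)]
-/

set_option linter.dupNamespace false

noncomputable section

open scoped Classical NumberField nonZeroDivisors

open Literature.NumberTheory.NumberFields Polynomial Module NumberField IsDedekindDomain Ideal

namespace Summit.BirchSwinnertonDyer.BirchSwinnertonDyer.Rank2Observatory.TwoDescCl

open TwoDescCubic ClFieldCert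

/-! ## The complex field clause on its own -/

namespace ClFieldCert

variable {K : Type*} [Field K] [NumberField K] {θ : K} (fc : ClFieldCert)

/-- `g` is irreducible (from the field clause). [folklore] -/
theorem irreducible_of_field (hfd : fc.checkField = true) : Irreducible (MonicCubic.polyQ fc.a fc.b fc.c) := by
  simp only [checkField, Bool.and_eq_true] at hfd
  exact irreducible_of_noRootMod hfd.1.1

/-- `Δ(g) < 0`. [folklore] -/
theorem disc_neg_of_field (hfd : fc.checkField = true) : MonicCubic.disc fc.a fc.b fc.c < 0 := by
  simp only [checkField, Bool.and_eq_true, decide_eq_true_eq] at hfd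
  exact hfd.1.2

/-- The interval facts: `0 ≤ lo < hi`, `g(lo) < 0 < g(hi)`. [folklore] -/
theorem interval_of_field (hfd : fc.checkField = true) :
    0 ≤ fc.lo ∧ fc.lo < fc.hi ∧ fc.lo ^ 3 + (fc.a : ℚ) * fc.lo ^ 2 + (fc.b : ℚ) * fc.lo + (fc.c : ℚ) < 0 ∧
      0 < fc.hi ^ 3 + (fc.a : ℚ) * fc.hi ^ 2 + (fc.b : ℚ) * fc.hi + (fc.c : ℚ) := by
  simp only [checkField, Bool.and_eq_true, decide_eq_true_eq] at hfd
  exact hfd.2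

/-- Unit rank `1`. [cite: Marcus2018, Ch. 5, Thm. 38] -/
theorem units_rank_of_field (hθ : aeval θ (MonicCubic.poly fc.a fc.b fc.c) = 0) (h3 : finrank ℚ K = 3)
    (hfd : fc.checkField = true) : NumberField.Units.rank K = 1 :=
  units_rank_eq_one_of_disc_neg (fc.irreducible_of_field hfd) hθ h3 (fc.disc_neg_of_field hfd)

/-- The real place with `lo < ρ(α) < hi`. [folklore] -/
theorem exists_rho_of_field (hθ : aeval θ (MonicCubic.poly fc.a fc.b fc.c) = 0) (h3 : finrank ℚ K = 3)
    (hfd : fc.checkField = true) : ∃ ρ : K →+* ℝ, ((fc.lo : ℚ) : ℝ) < ρ θ ∧ ρ θ < ((fc.hi : ℚ) : ℝ) := by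
  obtain ⟨-, hlt, hlo, hhi⟩ := fc.interval_of_field hfd
  exact exists_real_embedding_of_sign_change (fc.irreducible_of_field hfd) hθ h3 hlt hlo hhi

/-! ## The prime of a certified code (registry core) -/

variable {fc}

/-- The height-one prime `idealOf C` of a code certified present in the registry (junk `W₁` otherwise). -/
def codePrimeR (hθ : aeval θ (MonicCubic.poly fc.a fc.b fc.c) = 0) (h3 : finrank ℚ K = 3) (hR : fc.checkReg = true)
    (hpr : fc.primeList.Forall Nat.Prime) (C : PCode) : HeightOneSpectrum (𝓞 K) :=
  if h : (fc.primes.any fun e => e.p == C.1) = true ∧ C ∈ (fc.row C.1).codes then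
    primeOfCode (fc.irreducible_of_reg hR) hθ h3 (e := fc.row C.1) (fc.prime_of_mem hpr (row_mem h.1).1)
      (fc.row_check_of_mem_reg hR (row_mem h.1).1).1 h.2
  else fc.W₁r hθ h3 hR hpr

/-- A certified code prime is presented by its code. [folklore] -/
theorem codePrimeR_asIdeal (hθ : aeval θ (MonicCubic.poly fc.a fc.b fc.c) = 0) (h3 : finrank ℚ K = 3)
    (hR : fc.checkReg = true) (hpr : fc.primeList.Forall Nat.Prime) {C : PCode}
    (h₁ : (fc.primes.any fun e => e.p == C.1) = true) (h₂ : C ∈ (fc.row C.1).codes) :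
    (codePrimeR hθ h3 hR hpr C).asIdeal = idealOf hθ C := by
  rw [codePrimeR, dif_pos ⟨h₁, h₂⟩]
  rfl

end ClFieldCert

/-! ## Soundness from the registry core and a class-group generation certificate -/

section Sound

variable {K : Type*} [Field K] [NumberField K] {θ : K}

/-- **Soundness of the `r`-checker from the registry core, the complex field clause and ANY certificate that the
classes of the primes above `q` generate `Cl(K)`: `rank E(ℚ) ≤ r`** (the proof of `rank_le_of_checkLe_cl`, the
sweep result abstracted into the hypothesis `hcl`). [cite: Cassels1991LecturesEllipticCurves, §15] -/
theorem rank_le_of_checkLe_cl_reg (r : ℕ) (fc : ClFieldCert) (hθ : aeval θ (MonicCubic.poly fc.a fc.b fc.c) = 0)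
    (h3 : finrank ℚ K = 3) (hR : fc.checkReg = true) (hfd : fc.checkField = true)
    (hcl : Subgroup.closure {cl : ClassGroup (𝓞 K) | ∃ (J : Ideal (𝓞 K)) (hJ : J ∈ (Ideal (𝓞 K))⁰),
      ((fc.q : ℕ) : 𝓞 K) ∈ J ∧ ClassGroup.mk0 ⟨J, hJ⟩ = cl} = ⊤)
    (hpr : fc.primeList.Forall Nat.Prime) (cc : ClCurveCert)
    (hc : checkLe r fc cc = true) : ((⟨0, cc.A, 0, cc.B, cc.C⟩ : WeierstrassCurve ℚ)).mordellWeilRank ≤ r := by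
  classical
  have hirr := fc.irreducible_of_reg hR
  have h0 := (fc.interval_of_field hfd).1
  have hq := fc.q_prime hpr
  simp only [checkLe, Bool.and_eq_true, decide_eq_true_eq, List.all_eq_true, List.any_eq_true,
    Bool.or_eq_true, beq_iff_eq] at hc
  obtain ⟨⟨⟨⟨⟨⟨⟨⟨⟨⟨⟨⟨⟨⟨hΔ, hirrF⟩, hcub⟩, hder⟩, hdisc⟩, hND0⟩, hdn⟩, hdnC⟩, hcodes⟩, hdW1⟩, hdW2⟩, hQ⟩,
    hfamAll⟩, hcert⟩, hcount⟩ := hc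
  haveI hE := isElliptic_of_deltaShort_ne hΔ
  have hirrF' := irreducible_of_noRootMod hirrF
  -- `θ_E`, `D`, `M = D·q`
  have haev := aeval_lin_eq_zero_of_coords hθ cc.t hcub
  have hderiv : (3 : 𝓞 K) * (lin hθ cc.t.1 cc.t.2.1 cc.t.2.2) ^ 2 +
      2 * ((cc.A : ℤ) : 𝓞 K) * (lin hθ cc.t.1 cc.t.2.1 cc.t.2.2) + ((cc.B : ℤ) : 𝓞 K) =
        lin hθ cc.D.1 cc.D.2.1 cc.D.2.2 := by
    simpa using deriv_eq_of_coords hθ cc.t cc.D [] hder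
  have hD0 : (lin hθ cc.D.1 cc.D.2.1 cc.D.2.2 : 𝓞 K) ≠ 0 := lin_ne_zero_of_coords hirr hθ h3 _ hND0
  have hq0 : ((fc.q : ℕ) : 𝓞 K) ≠ 0 := by exact_mod_cast hq.ne_zero
  have hM0 : (lin hθ cc.D.1 cc.D.2.1 cc.D.2.2 : 𝓞 K) * ((fc.q : ℕ) : 𝓞 K) ≠ 0 := mul_ne_zero hD0 hq0
  have hgen := closure_tsupp_eq_top_of_dvd
    (dvd_mul_left ((fc.q : ℕ) : 𝓞 K) (lin hθ cc.D.1 cc.D.2.1 cc.D.2.2)) hcl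
  have hDM : ∀ v : HeightOneSpectrum (𝓞 K), (3 : 𝓞 K) * (lin hθ cc.t.1 cc.t.2.1 cc.t.2.2) ^ 2 +
      2 * ((cc.A : ℤ) : 𝓞 K) * (lin hθ cc.t.1 cc.t.2.1 cc.t.2.2) + ((cc.B : ℤ) : 𝓞 K) ∈ v.asIdeal →
      (lin hθ cc.D.1 cc.D.2.1 cc.D.2.2 : 𝓞 K) * ((fc.q : ℕ) : 𝓞 K) ∈ v.asIdeal := by
    intro v hv
    rw [hderiv] at hv
    exact Ideal.mul_mem_right _ _ hv
  have hDW₁ : (lin hθ cc.D.1 cc.D.2.1 cc.D.2.2 : 𝓞 K) ∉ (fc.W₁r hθ h3 hR hpr).asIdeal :=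
    lin_not_mem_of_invCert hθ _ (W₁r_asIdeal hθ h3 hR hpr) hdW1
  have hDW₂ : (lin hθ cc.D.1 cc.D.2.1 cc.D.2.2 : 𝓞 K) ∉ (fc.W₂r hθ h3 hR hpr).asIdeal :=
    lin_not_mem_of_invCert hθ _ (W₂r_asIdeal hθ h3 hR hpr) hdW2
  -- the support `T = {W₁, W₂} ∪ codes`
  set L := cc.codes.length with hL
  let Tf : Fin (L + 2) → HeightOneSpectrum (𝓞 K) := Matrix.vecCons (fc.W₁r hθ h3 hR hpr)
    (Matrix.vecCons (fc.W₂r hθ h3 hR hpr) fun i => codePrimeR hθ h3 hR hpr (cc.codes.get i))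
  have hT : ∀ w : HeightOneSpectrum (𝓞 K),
      (lin hθ cc.D.1 cc.D.2.1 cc.D.2.2 : 𝓞 K) * ((fc.q : ℕ) : 𝓞 K) ∈ w.asIdeal → ∃ i, Tf i = w := by
    intro w hw
    rcases w.isPrime.mem_or_mem hw with hD | hqw
    · obtain ⟨l, hl, hldvd, hlw⟩ := exists_prime_dvd_norm_mem w hD0 hD
      rw [natAbs_norm_lin_coords hirr hθ h3, hdn] at hldvd
      obtain ⟨a, ha, hla⟩ := (Prime.dvd_prod_iff hl.prime).mp hldvd
      obtain ⟨pe, hpe, rfl⟩ := List.mem_map.mp ha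
      obtain ⟨hany, hrowcodes⟩ := hdnC pe hpe
      have hany' : (fc.primes.any fun e => e.p == pe.1) = true := by simpa [List.any_eq_true] using hany
      obtain ⟨hrow, hrowp⟩ := row_mem hany'
      have hpp : (fc.row pe.1).p.Prime := fc.prime_of_mem hpr hrow
      have hl_eq : l = pe.1 :=
        (Nat.prime_dvd_prime_iff_eq hl (hrowp ▸ hpp)).mp (hl.dvd_of_dvd_pow hla)
      have hlw' : ((fc.row pe.1).p : 𝓞 K) ∈ w.asIdeal := by rw [hrowp, ← hl_eq]; exact hlw
      obtain ⟨C', hC', hw'⟩ :=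
        exists_code_of_natCast_mem hirr hθ h3 hpp (fc.row_check_of_mem_reg hR hrow).1 w hlw'
      rcases hrowcodes C' hC' with hmem | ⟨ci, -, hci, hinv⟩
      · obtain ⟨i, hi⟩ := List.mem_iff_get.mp hmem
        obtain ⟨hc1, hc2⟩ := hcodes _ (List.get_mem _ i)
        have hc1' : (fc.primes.any fun e => e.p == (cc.codes.get i).1) = true := by
          simpa [List.any_eq_true] using hc1
        refine ⟨i.succ.succ, HeightOneSpectrum.ext ?_⟩
        simp only [Tf, Matrix.cons_val_succ]
        rw [codePrimeR_asIdeal hθ h3 hR hpr hc1' hc2, hi, hw']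
      · exact absurd hD (lin_not_mem_of_invCert hθ w hw' hinv)
    · rcases eq_W₁r_or_W₂r hθ h3 hR hpr w hqw with rfl | rfl
      · exact ⟨0, by simp [Tf]⟩
      · exact ⟨1, by simp [Tf]⟩
  -- the family
  set fm := fam fc cc with hfm
  let W : Fin fm.length → 𝓞 K := fun j => lin hθ (fm.get j).2.2.g.1 (fm.get j).2.2.g.2.1 (fm.get j).2.2.g.2.2
  have hfam : ∀ j : Fin fm.length, famCheck fc cc.D (fm.get j) = true := fun j => hfamAll _ (List.get_mem _ j)
  have hW0 : ∀ j, W j ≠ 0 := fun j => lin_ne_zero_of_famCheck_reg hθ h3 hR (hfam j)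
  have hWval : ∀ j (v : HeightOneSpectrum (𝓞 K)),
      (lin hθ cc.D.1 cc.D.2.1 cc.D.2.2 : 𝓞 K) * ((fc.q : ℕ) : 𝓞 K) ∉ v.asIdeal →
        v.valuation K (algebraMap (𝓞 K) K (W j)) = 1 :=
    fun j v hv => valuation_eq_one_of_support _ _ (supp_of_famCheck_reg hθ h3 hR hpr (hfam j)) v hv
  obtain ⟨ρ, hlo, hhi⟩ := fc.exists_rho_of_field hθ h3 hfd
  -- independence modulo squares: the parity certificate
  have hind : ∀ S : Finset (Fin fm.length), IsSquare (∏ i ∈ S, algebraMap (𝓞 K) K (W i)) → S = ∅ := by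
    intro S hS
    refine indep_of_parity_certificate (fun i => algebraMap (𝓞 K) K (W i)) (bit fc cc) ?_ hcert S hS
    intro k S' hS'
    have hS'' : IsSquare (∏ i ∈ S', W i) := isSquare_prod_of_isSquare_prod_coe _ hS'
    obtain ⟨k, hk⟩ := k
    rcases k with _ | _ | _ | k
    · have h := even_card_of_isSquare_real ρ (fun i => algebraMap (𝓞 K) K (W i))
        (fun i => rho_ne_zero_of_famCheck_core hθ ρ hlo hhi h0 (hfam i)) hS'
      convert h using 2
      refine Finset.filter_congr (fun i _ => ?_)
      exact sign_iff_of_famCheck_core hθ ρ hlo hhi h0 (hfam i)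
    · exact even_card_of_isSquare_valuation (fc.W₁r hθ h3 hR hpr) W hW0 _
        (fun i => by
          show ((!decide ((2 : ℤ) ∣ famL₁ (fm.get i))) = true ↔ _)
          rw [log_W₁r_of_famCheck hθ h3 hR hpr (hfam i)]; simp) hS'
    · exact even_card_of_isSquare_valuation (fc.W₂r hθ h3 hR hpr) W hW0 _
        (fun i => by
          show ((!decide ((2 : ℤ) ∣ famL₂ (fm.get i))) = true ↔ _)
          rw [log_W₂r_of_famCheck hθ h3 hR hpr (hfam i)]; simp) hS'
    · have hk' : k < fc.chars.length := by omega
      have hch : fc.chars.getD k ((3 : ℕ), (0 : ℤ), (0 : ℤ)) ∈ fc.chars := by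
        rw [List.getD_eq_getElem?_getD, List.getElem?_eq_getElem hk', Option.getD_some]
        exact List.getElem_mem hk'
      obtain ⟨h2, ψ, hψ⟩ := fc.exists_psi_of_reg hθ h3 hR hpr hch
      haveI : Fact (fc.chars.getD k (3, 0, 0)).1.Prime := ⟨fc.char_prime hpr hch⟩
      have h := even_card_filter_eulerBit hθ (ℓ := (fc.chars.getD k (3, 0, 0)).1) (by omega) ψ hψ
        (fun i => (fm.get i).2.2.g) (fun i => not_dvd_evalInt_of_famCheck (hfam i) hch) hS''
      convert h using 2
      exact Finset.filter_congr (fun i _ => Iff.rfl)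
  -- spanning of the `T`-units modulo squares
  have hodd : Odd (finrank ℚ K) := by rw [h3]; decide
  have hn : fm.length = NumberField.Units.rank K + 1 + (L + 2) := by
    rw [fc.units_rank_of_field hθ h3 hfd]
    simp only [hfm, fam, List.length_cons, List.length_map, hL]
    omega
  have hspan : ∀ u : K, u ≠ 0 →
      (∀ v : HeightOneSpectrum (𝓞 K),
        (lin hθ cc.D.1 cc.D.2.1 cc.D.2.2 : 𝓞 K) * ((fc.q : ℕ) : 𝓞 K) ∉ v.asIdeal → v.valuation K u = 1) →
      ∃ U : Finset (Fin fm.length), IsSquare (u * ∏ j ∈ U, algebraMap (𝓞 K) K (W j)) :=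
    fun u hu huT => exists_isSquare_tunit_mul_prod hodd _ Tf hT hn (fun j => algebraMap (𝓞 K) K (W j))
      (fun j => RingOfIntegers.coe_ne_zero_iff.mpr (hW0 j)) hWval hind u hu huT
  -- the sieve is sound at rational points
  have hθQ : ∀ x : ℚ, algebraMap ℚ K x ≠ algebraMap (𝓞 K) K (lin hθ cc.t.1 cc.t.2.1 cc.t.2.2) :=
    ne_of_powIndep (powIndep_algebraMap hirrF' haev h3)
  have hFrel : (lin hθ cc.t.1 cc.t.2.1 cc.t.2.2 : 𝓞 K) ^ 3 + cc.A * (lin hθ cc.t.1 cc.t.2.1 cc.t.2.2) ^ 2 +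
      cc.B * (lin hθ cc.t.1 cc.t.2.1 cc.t.2.2) + cc.C = 0 := by
    apply RingOfIntegers.coe_injective
    simpa only [map_add, map_mul, map_pow, map_intCast, _root_.map_zero] using MonicCubic.theta_rel haev
  have hadm0 : adm fc cc ∅ ∅ = true := by
    simp only [adm, Bool.and_eq_true, decide_eq_true_eq, Finset.filter_empty, Finset.card_empty]
    exact ⟨⟨admStdQ_empty _ hQ _ _ _ _, by decide⟩, by decide⟩
  have hadm : ∀ x y : ℚ, y ^ 2 = x ^ 3 + cc.A * x ^ 2 + cc.B * x + cc.C →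
      ∀ (T : Finset (Fin 0)) (U : Finset (Fin fm.length)),
        IsSquare ((algebraMap ℚ K x - algebraMap (𝓞 K) K (lin hθ cc.t.1 cc.t.2.1 cc.t.2.2)) *
          (∏ i ∈ T, algebraMap (𝓞 K) K (((fun i : Fin 0 => i.elim0 : Fin 0 → (𝓞 K)ˣ) i : (𝓞 K)ˣ) : 𝓞 K)) *
            ∏ j ∈ U, algebraMap (𝓞 K) K (W j)) → adm fc cc T U = true := by
    intro x y hxy T U hsq
    have hcof := cofactor_pos_of_disc_neg (rho_theta_root ρ haev) hdisc
    have h1 : admStd (fun i : Fin 0 => i.elim0) (famNorm fc cc) (fun i : Fin 0 => i.elim0) (famSign fc cc) T U =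
        true :=
      admStd_sound hirrF' haev h3 ρ hcof (w := fun i : Fin 0 => algebraMap (𝓞 K) K
          (((fun i : Fin 0 => i.elim0 : Fin 0 → (𝓞 K)ˣ) i : (𝓞 K)ˣ) : 𝓞 K))
        (g := fun j => algebraMap (𝓞 K) K (W j)) (fun i => i.elim0)
        (fun j => RingOfIntegers.coe_ne_zero_iff.mpr (hW0 j)) (fun i => i.elim0)
        (fun j => norm_of_famCheck_reg hθ h3 hR) (fun i => i.elim0)
        (fun j => sign_iff_of_famCheck_core hθ ρ hlo hhi h0 (hfam j)) x y hxy T U hsq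
    have h2 := valRow_sound hFrel hθQ (fc.W₁r hθ h3 hR hpr) (by rw [hderiv]; exact hDW₁) hW0
      (r := fun j => bitRow fc (fm.get j) 1) (fun j => by
        show ((!decide ((2 : ℤ) ∣ famL₁ (fm.get j))) = true ↔ _)
        rw [show algebraMap (𝓞 K) K (W j) = ((W j : 𝓞 K) : K) from rfl,
          log_W₁r_of_famCheck hθ h3 hR hpr (hfam j)]; simp) x y hxy T U hsq
    have h3' := valRow_sound hFrel hθQ (fc.W₂r hθ h3 hR hpr) (by rw [hderiv]; exact hDW₂) hW0
      (r := fun j => bitRow fc (fm.get j) 2) (fun j => by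
        show ((!decide ((2 : ℤ) ∣ famL₂ (fm.get j))) = true ↔ _)
        rw [show algebraMap (𝓞 K) K (W j) = ((W j : 𝓞 K) : K) from rfl,
          log_W₂r_of_famCheck hθ h3 hR hpr (hfam j)]; simp) x y hxy T U hsq
    simp only [adm, Bool.and_eq_true]
    exact ⟨⟨admStdQ_of_admStd hQ h1, h2⟩, h3'⟩
  exact mordellWeilRank_le_of_coverSet_cl_lt (A := cc.A) (B := cc.B) (C := cc.C)
    (⟨0, cc.A, 0, cc.B, cc.C⟩ : WeierstrassCurve ℚ) rfl rfl rfl rfl rfl hirrF' haev h3 hM0 hgen hDM hW0 hspan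
    (Wu := fun i : Fin 0 => i.elim0) (adm := adm fc cc) hadm0 hadm (s' := r) hcount


end Sound

/-! ## The two-view field record, complex case -/

namespace ClFieldCertE

/-- **The complex two-view per-field checker**: the v2.0 complex field clause of `base` (irreducibility,
`Δ < 0`, the isolating interval) and the signature-free two-view core. Computable; `decide +kernel` once per
field. -/
def checkE (fe : ClFieldCertE) : Bool := fe.base.checkField && fe.checkCoreE

/-- The v2.0 field clause of a checked two-view record. -/
theorem checkField_of_checkE (fe : ClFieldCertE) (hE : fe.checkE = true) : fe.base.checkField = true := by
  simp only [checkE, Bool.and_eq_true] at hE; exact hE.1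

/-- The two-view core clause of a checked two-view record. -/
theorem checkCoreE_of_checkE (fe : ClFieldCertE) (hE : fe.checkE = true) : fe.checkCoreE = true := by
  simp only [checkE, Bool.and_eq_true] at hE; exact hE.2

end ClFieldCertE

section SoundE

variable {K : Type*} [Field K] [NumberField K] {θ : K}

/-- **`rank E(ℚ) = r`** from a checked two-view field record, an `r`-checked v2.0 curve record against its
`α`-view, and a tree lower bound `r ≤ rank`. [cite: CremonaAlgorithms1997, §3.6] -/
theorem rank_eq_of_checkLe_clE (r : ℕ) (fe : ClFieldCertE)
    (hθ : aeval θ (MonicCubic.poly fe.base.a fe.base.b fe.base.c) = 0) (h3 : finrank ℚ K = 3)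
    (hE : fe.checkE = true) (hpr : fe.primeListE.Forall Nat.Prime) (cc : ClCurveCert)
    (hc : checkLe r fe.base cc = true)
    (hlow : r ≤ (((⟨0, cc.A, 0, cc.B, cc.C⟩ : WeierstrassCurve ℤ)).map (Int.castRingHom ℚ)).mordellWeilRank) :
    (((⟨0, cc.A, 0, cc.B, cc.C⟩ : WeierstrassCurve ℤ)).map (Int.castRingHom ℚ)).mordellWeilRank = r := by
  have hV : ((⟨0, cc.A, 0, cc.B, cc.C⟩ : WeierstrassCurve ℤ)).map (Int.castRingHom ℚ) =
      (⟨0, cc.A, 0, cc.B, cc.C⟩ : WeierstrassCurve ℚ) := by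
    ext <;> simp [WeierstrassCurve.map]
  have hC := fe.checkCoreE_of_checkE hE
  refine le_antisymm ?_ hlow
  rw [hV]
  exact rank_le_of_checkLe_cl_reg r fe.base hθ h3 (fe.checkReg_of_coreE hC) (fe.checkField_of_checkE hE)
    (fe.closure_q_eq_top_of_coreE hθ h3 hC hpr) (fe.base_primeList hpr) cc hc

end SoundE

/-! ## `K`-free wrappers over the model `CubicField a b c` (the shape of every sharded row) -/

/-- **`rank E(ℚ) = r` from the two records** (model `(0, A, 0, B, C)`):
`rank_eq_of_certsELe r <fieldE> ⟨curve⟩ (by decide +kernel) (by norm_num [ClFieldCertE.primeListE, ClFieldCert.primeList]) (by decide +kernel) <lower bound>`.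
[cite: Cassels1991LecturesEllipticCurves, §15] [cite: CremonaAlgorithms1997, §3.6] -/
theorem rank_eq_of_certsELe (r : ℕ) (fe : ClFieldCertE) (cc : ClCurveCert) (hE : fe.checkE = true)
    (hpr : fe.primeListE.Forall Nat.Prime) (hc : checkLe r fe.base cc = true)
    (hlow : r ≤ (((⟨0, cc.A, 0, cc.B, cc.C⟩ : WeierstrassCurve ℤ)).map (Int.castRingHom ℚ)).mordellWeilRank) :
    (((⟨0, cc.A, 0, cc.B, cc.C⟩ : WeierstrassCurve ℤ)).map (Int.castRingHom ℚ)).mordellWeilRank = r := by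
  haveI : Fact (Irreducible (MonicCubic.polyQ fe.base.a fe.base.b fe.base.c)) :=
    ⟨fe.base.irreducible_of_field (fe.checkField_of_checkE hE)⟩
  exact rank_eq_of_checkLe_clE (K := CubicField fe.base.a fe.base.b fe.base.c) r fe
    (CubicField.aeval_root fe.base.a fe.base.b fe.base.c) (CubicField.finrank_eq fe.base.a fe.base.b fe.base.c)
    hE hpr cc hc hlow

/-- **`rank E(ℚ) = r` for the ORIGINAL model** `(a₁, a₂, a₃, a₄, a₆)` when the records certify its
completed-square model RESCALED by `d` — `(0, d²(a₁² + 4a₂), 0, 8d⁴(a₁a₃ + 2a₄), 16d⁶(a₃² + 4a₆))` — (rank is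
invariant under both variable changes; `d = 1` is the plain completed square). [cite: CremonaAlgorithms1997, §3.6]
[cite: SilvermanAEC2009, III.3.1(b)] -/
theorem rank_eq_of_certsELe_scaled (r : ℕ) (fe : ClFieldCertE) (cc : ClCurveCert) (hE : fe.checkE = true)
    (hpr : fe.primeListE.Forall Nat.Prime) (hc : checkLe r fe.base cc = true) (a₁ a₂ a₃ a₄ a₆ d : ℤ)
    (hd : d ≠ 0)
    (hABC : cc.A = d ^ 2 * (a₁ ^ 2 + 4 * a₂) ∧ cc.B = d ^ 4 * (8 * (a₁ * a₃ + 2 * a₄)) ∧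
      cc.C = d ^ 6 * (16 * (a₃ ^ 2 + 4 * a₆)))
    (hlow : r ≤ (((⟨a₁, a₂, a₃, a₄, a₆⟩ : WeierstrassCurve ℤ)).map (Int.castRingHom ℚ)).mordellWeilRank) :
    (((⟨a₁, a₂, a₃, a₄, a₆⟩ : WeierstrassCurve ℤ)).map (Int.castRingHom ℚ)).mordellWeilRank = r := by
  obtain ⟨hA, hB, hC⟩ := hABC
  -- completed square
  have hV : ((⟨0, a₁ ^ 2 + 4 * a₂, 0, 8 * (a₁ * a₃ + 2 * a₄), 16 * (a₃ ^ 2 + 4 * a₆)⟩ : WeierstrassCurve ℤ)).map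
        (Int.castRingHom ℚ) =
      (⟨Units.mk0 (1 / 2 : ℚ) (by norm_num), 0, -(a₁ : ℚ) / 2, -(a₃ : ℚ) / 2⟩ :
        WeierstrassCurve.VariableChange ℚ) •
        (((⟨a₁, a₂, a₃, a₄, a₆⟩ : WeierstrassCurve ℤ)).map (Int.castRingHom ℚ)) := by
    ext <;> simp only [WeierstrassCurve.map_a₁, WeierstrassCurve.map_a₂, WeierstrassCurve.map_a₃,
      WeierstrassCurve.map_a₄, WeierstrassCurve.map_a₆, WeierstrassCurve.variableChange_a₁,
      WeierstrassCurve.variableChange_a₂, WeierstrassCurve.variableChange_a₃,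
      WeierstrassCurve.variableChange_a₄, WeierstrassCurve.variableChange_a₆, Units.val_inv_eq_inv_val,
      Units.val_mk0, eq_intCast, Int.cast_zero] <;> push_cast <;> ring
  have hr₁ : (((⟨0, a₁ ^ 2 + 4 * a₂, 0, 8 * (a₁ * a₃ + 2 * a₄), 16 * (a₃ ^ 2 + 4 * a₆)⟩ : WeierstrassCurve ℤ)).map
        (Int.castRingHom ℚ)).mordellWeilRank =
      (((⟨a₁, a₂, a₃, a₄, a₆⟩ : WeierstrassCurve ℤ)).map (Int.castRingHom ℚ)).mordellWeilRank := by
    rw [hV]; exact WeierstrassCurve.mordellWeilRank_variableChange_holds _ _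
  -- rescaling
  have hS : scaleModel (⟨0, a₁ ^ 2 + 4 * a₂, 0, 8 * (a₁ * a₃ + 2 * a₄), 16 * (a₃ ^ 2 + 4 * a₆)⟩ :
      WeierstrassCurve ℤ) d = ⟨0, cc.A, 0, cc.B, cc.C⟩ := by
    simp only [scaleModel, hA, hB, hC, mul_zero]
  have hr₂ := mordellWeilRank_scaleModel
    (⟨0, a₁ ^ 2 + 4 * a₂, 0, 8 * (a₁ * a₃ + 2 * a₄), 16 * (a₃ ^ 2 + 4 * a₆)⟩ : WeierstrassCurve ℤ) hd
  rw [hS] at hr₂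
  rw [← hr₁, ← hr₂] at hlow ⊢
  exact rank_eq_of_certsELe r fe cc hE hpr hc hlow

/-- The plain completed-square shape (`d = 1`). [cite: CremonaAlgorithms1997, §3.6] -/
theorem rank_eq_of_certsELe_complSq (r : ℕ) (fe : ClFieldCertE) (cc : ClCurveCert) (hE : fe.checkE = true)
    (hpr : fe.primeListE.Forall Nat.Prime) (hc : checkLe r fe.base cc = true) (a₁ a₂ a₃ a₄ a₆ : ℤ)
    (hABC : cc.A = a₁ ^ 2 + 4 * a₂ ∧ cc.B = 8 * (a₁ * a₃ + 2 * a₄) ∧ cc.C = 16 * (a₃ ^ 2 + 4 * a₆))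
    (hlow : r ≤ (((⟨a₁, a₂, a₃, a₄, a₆⟩ : WeierstrassCurve ℤ)).map (Int.castRingHom ℚ)).mordellWeilRank) :
    (((⟨a₁, a₂, a₃, a₄, a₆⟩ : WeierstrassCurve ℤ)).map (Int.castRingHom ℚ)).mordellWeilRank = r :=
  rank_eq_of_certsELe_scaled r fe cc hE hpr hc a₁ a₂ a₃ a₄ a₆ 1 one_ne_zero
    (by obtain ⟨hA, hB, hC⟩ := hABC; exact ⟨by rw [hA]; ring, by rw [hB]; ring, by rw [hC]; ring⟩) hlow

end Summit.BirchSwinnertonDyer.BirchSwinnertonDyer.Rank2Observatory.TwoDescCl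

end
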